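import Mathlib
import HarnessLib

/-!
# Two-sided power bounds for Ikhlef–Ponsaing's two-step recursion

Helper file for stub `stub_touchExponent` (S3) of line `SketchIdeatorTwo` of crux `SymmetryUpgradeR`
(stmt-CriticalPhenomena-17239, route CardySelfRefinement), stage T1 (pure real analysis).

A sequence `W : ℕ → ℝ` with `W 0 = 1` satisfying Ikhlef–Ponsaing's recursion in ratio form
(J. Stat. Phys. 149 (2012), arXiv:1202.5476, Prop. 4.7 ⇒ `P_b(2m+3)(3m+4)(4m+7)(6m+5) =
P_b(2m+1)(3m+5)(4m+3)(6m+7)`) satisfies the two-sided POWER bound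
`3^{-1/3} m^{-1/3} ≤ W m ≤ m^{-1/3}` for `m ≥ 1` — the up-to-constants form of the log-form
sibling `stub_recursionExponent` (`log W m / log m → -1/3`,
`Theorems/CardyBoundaryCoulombGasHalfPlaneOneArmThirdRecursionExponent.lean`, whose envelope lemmas
are private there and are re-derived here).

Proof (elementary, no Gamma functions). With `N m = (3m+5)(4m+3)(6m+7)`,
`D m = (3m+4)(4m+7)(6m+5) > 0`: `W (m+1) = W m · N m / D m`, `W m > 0`; the polynomials
`(x+1) D(x)³ - N(x)³ (x+2)` and `N(x)³ (2x+3) - (2x+1) D(x)³` have non-negative coefficients, so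
`W m ^ 3 · (m+1)` is non-increasing and `W m ^ 3 · (2m+1)` non-decreasing, both `= 1` at `m = 0`:
`1/(2m+1) ≤ W m ^ 3 ≤ 1/(m+1)`, hence `(3m)⁻¹ ≤ W m ^ 3 ≤ m⁻¹` for `m ≥ 1`; take cube roots.
-/

namespace Summit.CriticalPhenomena.CardyFormulaZ2.Theorems.SymmetryUpgradeR.SwallowingSkeleton

/-- Upper polynomial inequality: `N(x)³ (x+2) ≤ (x+1) D(x)³` for `x ≥ 0`
(the difference is a polynomial with non-negative coefficients). -/
private theorem recTS_poly_upper (x : ℝ) (hx : 0 ≤ x) :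
    ((3 * x + 5) * (4 * x + 3) * (6 * x + 7)) ^ 3 * (x + 2) ≤
      (x + 1) * ((3 * x + 4) * (4 * x + 7) * (6 * x + 5)) ^ 3 := by
  have hQ : 0 ≤ 428750 + 2960825 * x + 8831235 * x ^ 2 + 14862058 * x ^ 3 + 15438042 * x ^ 4 +
      10138248 * x ^ 5 + 4111560 * x ^ 6 + 941760 * x ^ 7 + 93312 * x ^ 8 := by positivity
  have key : (x + 1) * ((3 * x + 4) * (4 * x + 7) * (6 * x + 5)) ^ 3 =
      ((3 * x + 5) * (4 * x + 3) * (6 * x + 7)) ^ 3 * (x + 2) +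
      (428750 + 2960825 * x + 8831235 * x ^ 2 + 14862058 * x ^ 3 + 15438042 * x ^ 4 +
        10138248 * x ^ 5 + 4111560 * x ^ 6 + 941760 * x ^ 7 + 93312 * x ^ 8) := by
    ring
  linarith [key, hQ]

/-- Lower polynomial inequality: `(2x+1) D(x)³ ≤ N(x)³ (2x+3)` for `x ≥ 0`
(the difference is a polynomial with non-negative coefficients). -/
private theorem recTS_poly_lower (x : ℝ) (hx : 0 ≤ x) :
    (2 * x + 1) * ((3 * x + 4) * (4 * x + 7) * (6 * x + 5)) ^ 3 ≤
      ((3 * x + 5) * (4 * x + 3) * (6 * x + 7)) ^ 3 * (2 * x + 3) := by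
  have hQ : 0 ≤ 728875 + 5143775 * x + 15679125 * x ^ 2 + 26955724 * x ^ 3 + 28587384 * x ^ 4 +
      19154304 * x ^ 5 + 7920720 * x ^ 6 + 1848960 * x ^ 7 + 186624 * x ^ 8 := by positivity
  have key : ((3 * x + 5) * (4 * x + 3) * (6 * x + 7)) ^ 3 * (2 * x + 3) =
      (2 * x + 1) * ((3 * x + 4) * (4 * x + 7) * (6 * x + 5)) ^ 3 +
      (728875 + 5143775 * x + 15679125 * x ^ 2 + 26955724 * x ^ 3 + 28587384 * x ^ 4 +
        19154304 * x ^ 5 + 7920720 * x ^ 6 + 1848960 * x ^ 7 + 186624 * x ^ 8) := by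
    ring
  linarith [key, hQ]

/-- The recursion in ratio form: `W (m+1) = W m · N m / D m`. -/
private theorem recTS_succ (W : ℕ → ℝ)
    (hrec : ∀ m : ℕ, W (m + 1) * ((3 * (m : ℝ) + 4) * (4 * (m : ℝ) + 7) * (6 * (m : ℝ) + 5)) =
      W m * ((3 * (m : ℝ) + 5) * (4 * (m : ℝ) + 3) * (6 * (m : ℝ) + 7))) (m : ℕ) :
    W (m + 1) = W m * (((3 * (m : ℝ) + 5) * (4 * (m : ℝ) + 3) * (6 * (m : ℝ) + 7)) /
      ((3 * (m : ℝ) + 4) * (4 * (m : ℝ) + 7) * (6 * (m : ℝ) + 5))) := by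
  have hD : (0 : ℝ) < (3 * (m : ℝ) + 4) * (4 * (m : ℝ) + 7) * (6 * (m : ℝ) + 5) := by positivity
  rw [mul_div_assoc', eq_div_iff hD.ne']
  exact hrec m

/-- Positivity of the solution: `0 < W m`. -/
private theorem recTS_pos (W : ℕ → ℝ) (h0 : W 0 = 1)
    (hrec : ∀ m : ℕ, W (m + 1) * ((3 * (m : ℝ) + 4) * (4 * (m : ℝ) + 7) * (6 * (m : ℝ) + 5)) =
      W m * ((3 * (m : ℝ) + 5) * (4 * (m : ℝ) + 3) * (6 * (m : ℝ) + 7))) (m : ℕ) :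
    0 < W m := by
  induction m with
  | zero => rw [h0]; exact one_pos
  | succ m ih =>
    rw [recTS_succ W hrec m]
    positivity

/-- Upper envelope: `W m ^ 3 · (m+1) ≤ 1` (non-increasing, equals `1` at `0`). -/
private theorem recTS_cube_upper (W : ℕ → ℝ) (h0 : W 0 = 1)
    (hrec : ∀ m : ℕ, W (m + 1) * ((3 * (m : ℝ) + 4) * (4 * (m : ℝ) + 7) * (6 * (m : ℝ) + 5)) =
      W m * ((3 * (m : ℝ) + 5) * (4 * (m : ℝ) + 3) * (6 * (m : ℝ) + 7))) (m : ℕ) :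
    W m ^ 3 * ((m : ℝ) + 1) ≤ 1 := by
  induction m with
  | zero => simp [h0]
  | succ m ih =>
    have hu : 0 < W m := recTS_pos W h0 hrec m
    have hD : (0 : ℝ) < (3 * (m : ℝ) + 4) * (4 * (m : ℝ) + 7) * (6 * (m : ℝ) + 5) := by
      positivity
    have step : W (m + 1) ^ 3 * ((m : ℝ) + 2) ≤ W m ^ 3 * ((m : ℝ) + 1) := by
      rw [recTS_succ W hrec m, mul_pow, div_pow, mul_assoc]
      refine mul_le_mul_of_nonneg_left ?_ (pow_nonneg hu.le 3)
      rw [div_mul_eq_mul_div, div_le_iff₀ (pow_pos hD 3)]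
      exact recTS_poly_upper m (Nat.cast_nonneg m)
    push_cast
    linarith

/-- Lower envelope: `1 ≤ W m ^ 3 · (2m+1)` (non-decreasing, equals `1` at `0`). -/
private theorem recTS_cube_lower (W : ℕ → ℝ) (h0 : W 0 = 1)
    (hrec : ∀ m : ℕ, W (m + 1) * ((3 * (m : ℝ) + 4) * (4 * (m : ℝ) + 7) * (6 * (m : ℝ) + 5)) =
      W m * ((3 * (m : ℝ) + 5) * (4 * (m : ℝ) + 3) * (6 * (m : ℝ) + 7))) (m : ℕ) :
    1 ≤ W m ^ 3 * (2 * (m : ℝ) + 1) := by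
  induction m with
  | zero => simp [h0]
  | succ m ih =>
    have hu : 0 < W m := recTS_pos W h0 hrec m
    have hD : (0 : ℝ) < (3 * (m : ℝ) + 4) * (4 * (m : ℝ) + 7) * (6 * (m : ℝ) + 5) := by
      positivity
    have step : W m ^ 3 * (2 * (m : ℝ) + 1) ≤ W (m + 1) ^ 3 * (2 * (m : ℝ) + 3) := by
      rw [recTS_succ W hrec m, mul_pow, div_pow, mul_assoc]
      refine mul_le_mul_of_nonneg_left ?_ (pow_nonneg hu.le 3)
      rw [div_mul_eq_mul_div, le_div_iff₀ (pow_pos hD 3)]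
      exact recTS_poly_lower m (Nat.cast_nonneg m)
    push_cast
    linarith

/-- Cube roots, upper: `x ^ 3 ≤ y⁻¹` gives `x ≤ y ^ (-1/3)` (`0 ≤ x`, `0 < y`). -/
private theorem recTS_le_rpow {x y : ℝ} (hx : 0 ≤ x) (hy : 0 < y) (h : x ^ 3 ≤ y⁻¹) :
    x ≤ y ^ (-(1 / 3 : ℝ)) := by
  have h1 : (x ^ 3) ^ ((3 : ℕ) : ℝ)⁻¹ ≤ (y⁻¹) ^ ((3 : ℕ) : ℝ)⁻¹ :=
    Real.rpow_le_rpow (by positivity) h (by positivity)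
  rw [Real.pow_rpow_inv_natCast hx (by norm_num), Real.inv_rpow hy.le, ← Real.rpow_neg hy.le] at h1
  convert h1 using 2
  norm_num

/-- Cube roots, lower: `y⁻¹ ≤ x ^ 3` gives `y ^ (-1/3) ≤ x` (`0 ≤ x`, `0 < y`). -/
private theorem recTS_rpow_le {x y : ℝ} (hx : 0 ≤ x) (hy : 0 < y) (h : y⁻¹ ≤ x ^ 3) :
    y ^ (-(1 / 3 : ℝ)) ≤ x := by
  have h1 : (y⁻¹) ^ ((3 : ℕ) : ℝ)⁻¹ ≤ (x ^ 3) ^ ((3 : ℕ) : ℝ)⁻¹ :=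
    Real.rpow_le_rpow (by positivity) h (by positivity)
  rw [Real.pow_rpow_inv_natCast hx (by norm_num), Real.inv_rpow hy.le, ← Real.rpow_neg hy.le] at h1
  convert h1 using 2
  norm_num

/-- **T1 `touchExponent_recursionTwoSided`** (registered helper for `stub_touchExponent`). A
solution `W` of Ikhlef–Ponsaing's two-step recursion
`W (m+1) · (3m+4)(4m+7)(6m+5) = W m · (3m+5)(4m+3)(6m+7)` with `W 0 = 1` obeys the two-sided power
law of exponent `-1/3` UP TO CONSTANTS: `c m^{-1/3} ≤ W m ≤ C m^{-1/3}` for `m ≥ 1` (in fact with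
`c = 3^{-1/3}`, `C = 1`, from `1/(2m+1) ≤ W m ^ 3 ≤ 1/(m+1)`). -/
theorem touchExponent_recursionTwoSided : ∀ W : ℕ → ℝ, W 0 = 1 → (∀ m : ℕ, W (m + 1) * ((3 * (m : ℝ) + 4) * (4 * (m : ℝ) + 7) * (6 * (m : ℝ) + 5)) = W m * ((3 * (m : ℝ) + 5) * (4 * (m : ℝ) + 3) * (6 * (m : ℝ) + 7))) → ∃ c C : ℝ, 0 < c ∧ ∀ m : ℕ, 1 ≤ m → c * (m : ℝ) ^ (-(1 / 3 : ℝ)) ≤ W m ∧ W m ≤ C * (m : ℝ) ^ (-(1 / 3 : ℝ)) := by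
  intro W h0 hrec
  refine ⟨(3 : ℝ) ^ (-(1 / 3 : ℝ)), 1, by positivity, fun m hm => ?_⟩
  have hm1 : (1 : ℝ) ≤ m := by exact_mod_cast hm
  have hm0 : (0 : ℝ) < m := by linarith
  have hu : 0 < W m := recTS_pos W h0 hrec m
  constructor
  · -- lower bound: `(3m)⁻¹ ≤ (2m+1)⁻¹ ≤ W m ^ 3`
    have h1 : 1 ≤ W m ^ 3 * (2 * (m : ℝ) + 1) := recTS_cube_lower W h0 hrec m
    have h2 : (3 * (m : ℝ))⁻¹ ≤ W m ^ 3 := by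
      rw [inv_le_iff_one_le_mul₀ (by positivity)]
      nlinarith [pow_pos hu 3, hm1]
    have h3 := recTS_rpow_le hu.le (by positivity) h2
    rwa [Real.mul_rpow (by norm_num) hm0.le] at h3
  · -- upper bound: `W m ^ 3 ≤ (m+1)⁻¹ ≤ m⁻¹`
    have h1 : W m ^ 3 * ((m : ℝ) + 1) ≤ 1 := recTS_cube_upper W h0 hrec m
    have h2 : W m ^ 3 ≤ (m : ℝ)⁻¹ := by
      rw [← one_div, le_div_iff₀ hm0]
      nlinarith [pow_pos hu 3]
    rw [one_mul]
    exact recTS_le_rpow hu.le hm0 h2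

end Summit.CriticalPhenomena.CardyFormulaZ2.Theorems.SymmetryUpgradeR.SwallowingSkeleton
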